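import Literature.MathematicalPhysics.StatisticalMechanics.Theil2006ReferenceUniqueness
import Literature.MathematicalPhysics.StatisticalMechanics.Theil2006SimplexCover
import HarnessLib

/-!
# Theil 2006, §4.2 (proof of Proposition 4.8, construction of `Φ`): extension of local discrete
imbeddings over a defect-free disc, wheel by wheel

Topic `Literature/MathematicalPhysics/StatisticalMechanics`; companion of `Theil2006.lean`
(F. Theil, *A proof of crystallization in two dimensions*, Comm. Math. Phys. **262** (2006)
209–236, accepted preprint of 26 Aug 2005), Appendix §4.2. Everything here is PROVED.

## Source, as printed (preprint p. 21), and what this file proves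

In the proof of Proposition 4.8 the label map `Φ` of a defect-free disc is defined by continuing
the local charts of Lemma 4.7 (`IsHexagonalNbhd.exists_discreteImbedding`: every hexagonal
neighbourhood `𝒩(x)` carries a discrete imbedding, unique given its values at `x` and at one
neighbour) along discrete paths ((64)), the consistency being Lemma 4.6. This file performs the
continuation as an induction over the particles of the disc `{b : |y(b) − y(x_c)| < ρ₀}` taken in
the order of their distance to `y(x_c)`:

* `Theil2006.exists_localCharts` (**the label map**): if `y` satisfies (13) with
  `0 < α ≤ 1/200` and no particle within `ρ₀ + 1 + α` of `y(x_c)` is a defect, there is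
  `Φ : X → ℤ²` such that every particle `q` of the disc has a discrete imbedding of `𝒩(q)` that
  agrees with `Φ` at all points of `𝒩(q)` inside the disc; in particular (`exists_charted`)
  `Φ ↾ 𝒩(q)` is a discrete imbedding for every `q` with `|y(q) − y(x_c)| < ρ₀ − 1 − α`.

The induction step adds the farthest particle `z`; its already-labelled neighbours are the rim
particles of the wheel `𝒩(z)` that are closer to `y(x_c)`, and the geometric input is that these
form an ARC of the hexagon (`IsHexagonalNbhd.exists_arc_base`: at most one "entry" when walking
around the rim, `IsHexagonalNbhd.entries_subsingleton`) — proved angle-free from the frame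
identities of `ℝ²` and the side lengths of the wheel (`1 ± α`). Along an arc, consecutive charts
agree at `z` because two discrete imbeddings agreeing on an `𝒮`-bond agree on the third vertex of
an `𝒮`-triangle (`(20)`, `IsDiscreteImbeddingOn.sub_eq_rot60_of_det_pos`).

[cite: Theil2006, §4.2 proof of Proposition 4.8 with Lemma 4.6, Lemma 4.7 (preprint pp. 20–21);
our combinatorial form — induction on the distance to the centre replaces the path sums (64)]
-/

namespace Literature.MathematicalPhysics.StatisticalMechanics

namespace Theil2006

open Metric Set

/-! ### Frame identities in `ℝ²` -/

section Frame

/-- `‖v‖² = v₀² + v₁²`. [folklore] -/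
private theorem norm_sq_coords' (v : Plane) : ‖v‖ ^ 2 = v 0 ^ 2 + v 1 ^ 2 := by
  rw [EuclideanSpace.norm_eq, Real.sq_sqrt (Finset.sum_nonneg fun _ _ => sq_nonneg _),
    Fin.sum_univ_two, Real.norm_eq_abs, Real.norm_eq_abs, sq_abs, sq_abs]

/-- `‖u − v‖² = ‖u‖² − 2⟨u,v⟩ + ‖v‖²`. [folklore] -/
private theorem norm_sub_sq_ip' (u v : Plane) : ‖u - v‖ ^ 2 = ‖u‖ ^ 2 - 2 * ip u v + ‖v‖ ^ 2 := by
  rw [norm_sq_coords', norm_sq_coords', norm_sq_coords', ip]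
  simp only [PiLp.sub_apply]
  ring

/-- Lagrange's identity. [folklore] -/
private theorem ip_sq_add_det₂_sq' (u v : Plane) : ip u v ^ 2 + det₂ u v ^ 2 = ‖u‖ ^ 2 * ‖v‖ ^ 2 := by
  rw [norm_sq_coords', norm_sq_coords', ip, det₂]
  ring

/-- The frame identity for inner products: `‖u‖² ⟨a, w⟩ = ⟨a, u⟩⟨u, w⟩ + det(u, a) det(u, w)`. [folklore] -/
private theorem frame_ip (u a w : Plane) :
    ‖u‖ ^ 2 * ip a w = ip a u * ip u w + det₂ u a * det₂ u w := by
  rw [norm_sq_coords', ip, ip, ip, det₂, det₂]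
  ring

/-- The frame identity for determinants: `‖u‖² det(a, b) = ⟨a, u⟩ det(u, b) − det(u, a)⟨u, b⟩`. [folklore] -/
private theorem frame_det (u a b : Plane) :
    ‖u‖ ^ 2 * det₂ a b = ip a u * det₂ u b - det₂ u a * ip u b := by
  rw [norm_sq_coords', ip, ip, det₂, det₂, det₂]
  ring

/-- `⟨u, v⟩ = ⟨v, u⟩`. [folklore] -/
private theorem ip_comm' (u v : Plane) : ip u v = ip v u := by
  unfold ip; ring

/-- `det(u, v) = −det(v, u)`. [folklore] -/
private theorem det₂_swap (u v : Plane) : det₂ u v = -det₂ v u := by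
  unfold det₂; ring

end Frame

/-! ### Wheel geometry without angles -/

section Wheel

variable {X : Type*} {α : ℝ} {y : X → Plane} {z : X} {p : Fin 6 → X}

/-- `(i - 1) + 1 = i` in `Fin 6`. [folklore] -/
private theorem fin6_sub_one_add_one (i : Fin 6) : i - 1 + 1 = i := sub_add_cancel i 1

/-- `i + 1 + 1 = i + 2` in `Fin 6`. [folklore] -/
private theorem f11 (i : Fin 6) : i + 1 + 1 = i + 2 := by rw [add_assoc]; rfl

/-- `i + 2 + 1 = i + 3` in `Fin 6`. [folklore] -/
private theorem f21 (i : Fin 6) : i + 2 + 1 = i + 3 := by rw [add_assoc]; rfl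

/-- `i + 1 + 2 = i + 3` in `Fin 6`. [folklore] -/
private theorem f12 (i : Fin 6) : i + 1 + 2 = i + 3 := by rw [add_assoc]; rfl

/-- `i + 4 + 2 = i` in `Fin 6`. [folklore] -/
private theorem f42 (i : Fin 6) : i + 4 + 2 = i := by
  rw [add_assoc, show (4 : Fin 6) + 2 = 0 by decide, add_zero]

/-- `i + 5 = i - 1` in `Fin 6`. [folklore] -/
private theorem f5 (i : Fin 6) : i + 5 = i - 1 := by
  rw [eq_sub_iff_add_eq, add_assoc, show (5 : Fin 6) + 1 = 0 by decide, add_zero]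

/-- Inner product of consecutive spokes: `⟨v_i, v_{i+1}⟩ ∈ [0.485, 0.515]`. [cite: Theil2006, §4.2 Lemma 4.7 (preprint p. 20); our constant] -/
private theorem ip_succ_bounds (H : IsHexagonalNbhd α y z p) (hα : 0 < α) (hα' : α ≤ 1 / 200)
    (i : Fin 6) :
    485 / 1000 ≤ ip (y (p (i + 1)) - y z) (y (p i) - y z) ∧
      ip (y (p (i + 1)) - y z) (y (p i) - y z) ≤ 516 / 1000 := by
  obtain ⟨h1, h1'⟩ := H.norm_spoke i
  obtain ⟨h2, h2'⟩ := H.norm_spoke (i + 1)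
  obtain ⟨h3, h3'⟩ := H.norm_rim i
  have e := norm_sub_sq_ip' (y (p (i + 1)) - y z) (y (p i) - y z)
  have hα0 : 0 ≤ 1 - α := by linarith
  have s1 := pow_le_pow_left₀ hα0 h1 2
  have s1' := pow_le_pow_left₀ (norm_nonneg _) h1' 2
  have s2 := pow_le_pow_left₀ hα0 h2 2
  have s2' := pow_le_pow_left₀ (norm_nonneg _) h2' 2
  have s3 := pow_le_pow_left₀ hα0 h3 2
  have s3' := pow_le_pow_left₀ (norm_nonneg _) h3' 2
  constructor <;> nlinarith

/-- Spoke norms squared. [cite: Theil2006, §4.2 Lemma 4.7 (preprint p. 20); our constant] -/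
private theorem spoke_sq_bounds (H : IsHexagonalNbhd α y z p) (hα : 0 < α) (hα' : α ≤ 1 / 200)
    (i : Fin 6) : 99 / 100 ≤ ‖y (p i) - y z‖ ^ 2 ∧ ‖y (p i) - y z‖ ^ 2 ≤ 10101 / 10000 := by
  obtain ⟨h1, h1'⟩ := H.norm_spoke i
  have hα0 : 0 ≤ 1 - α := by linarith
  have s1 := pow_le_pow_left₀ hα0 h1 2
  have s1' := pow_le_pow_left₀ (norm_nonneg _) h1' 2
  constructor <;> nlinarith

/-- **Second neighbours along the rim point away from each other**: `⟨v_i, v_{i+2}⟩ ≤ −0.434`.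
[cite: Theil2006, §4.2 Lemma 4.7 (preprint p. 20); our constant] -/
private theorem ip_add_two_le (H : IsHexagonalNbhd α y z p) (hα : 0 < α) (hα' : α ≤ 1 / 200)
    (i : Fin 6) : ip (y (p (i + 2)) - y z) (y (p i) - y z) ≤ -(434 / 1000) := by
  obtain ⟨u, hu⟩ : ∃ u : Plane, u = y (p (i + 1)) - y z := ⟨_, rfl⟩
  obtain ⟨a, ha⟩ : ∃ a : Plane, a = y (p (i + 2)) - y z := ⟨_, rfl⟩
  obtain ⟨w, hw⟩ : ∃ w : Plane, w = y (p i) - y z := ⟨_, rfl⟩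
  have hP1 := ip_succ_bounds H hα hα' i
  have hP2 := ip_succ_bounds H hα hα' (i + 1)
  have hQ1 : 21 / 25 ≤ det₂ (y (p i) - y z) (y (p (i + 1)) - y z) := H.le_det₂ hα hα' i
  have hQ2 := H.le_det₂ hα hα' (i + 1)
  have hu1 := spoke_sq_bounds H hα hα' (i + 1)
  rw [f11] at hP2 hQ2
  rw [← hu, ← hw] at hP1 hQ1
  rw [← hu, ← ha] at hP2 hQ2
  rw [← hu] at hu1
  rw [← ha, ← hw]
  obtain ⟨hP1, hP1'⟩ := hP1
  obtain ⟨hP2, hP2'⟩ := hP2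
  obtain ⟨hu1, hu1'⟩ := hu1
  have hQ1' : det₂ u w ≤ -(21 / 25) := by rw [det₂_swap]; linarith
  have hf := frame_ip u a w
  -- ‖u‖² ⟨a, w⟩ ≤ 0.516² − 0.84² = −0.4393
  have hprod1 : ip a u * ip u w ≤ 516 / 1000 * (516 / 1000) :=
    mul_le_mul hP2' hP1' (by linarith) (by linarith)
  have hprod2 : det₂ u a * det₂ u w ≤ 21 / 25 * (-(21 / 25)) := by
    have : det₂ u a * det₂ u w ≤ det₂ u a * (-(21 / 25)) :=
      mul_le_mul_of_nonneg_left hQ1' (by linarith)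
    nlinarith
  have h1 : ‖u‖ ^ 2 * ip a w ≤ -(4393 / 10000) := by rw [hf]; linarith
  by_contra hcon
  rw [not_le] at hcon
  have : ‖u‖ ^ 2 * (-(434 / 1000)) < ‖u‖ ^ 2 * ip a w :=
    mul_lt_mul_of_pos_left hcon (by linarith)
  nlinarith

/-- The real-arithmetic core of `ip_add_three_le`. [folklore] -/
private theorem three_core {Nu Nm X T D P1 P2 P3 Q1 Q2 Q3 : ℝ} (hNu : 99 / 100 ≤ Nu)
    (hNu' : Nu ≤ 10101 / 10000) (hNm : 99 / 100 ≤ Nm) (hNm' : Nm ≤ 10101 / 10000)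
    (hP1 : 485 / 1000 ≤ P1)
    (hP2 : 485 / 1000 ≤ P2) (hP3 : 485 / 1000 ≤ P3) (hQ1 : 21 / 25 ≤ Q1) (hQ2 : 21 / 25 ≤ Q2)
    (hQ3 : 21 / 25 ≤ Q3) (hT : T ≤ -(434 / 1000)) (hfd : Nm * D = P2 * Q3 + Q2 * P3)
    (hf : Nu * X = T * P1 - D * Q1) : X ≤ -(434 / 1000) := by
  have t1 : 485 / 1000 * (21 / 25) ≤ P2 * Q3 := mul_le_mul hP2 hQ3 (by norm_num) (by linarith)
  have t2 : 21 / 25 * (485 / 1000) ≤ Q2 * P3 := mul_le_mul hQ2 hP3 (by norm_num) (by linarith)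
  have hD : 806 / 1000 ≤ D := by
    by_contra hcon
    rw [not_le] at hcon
    have h1 : 8148 / 10000 ≤ Nm * D := by rw [hfd]; linarith
    have h2 : Nm * D < Nm * (806 / 1000) := mul_lt_mul_of_pos_left hcon (by linarith)
    nlinarith
  have t3 : T * P1 ≤ -(434 / 1000) * (485 / 1000) := by
    have : T * P1 ≤ -(434 / 1000) * P1 := mul_le_mul_of_nonneg_right hT (by linarith)
    nlinarith
  have t4 : 806 / 1000 * (21 / 25) ≤ D * Q1 := mul_le_mul hD hQ1 (by norm_num) (by linarith)
  have h1 : Nu * X ≤ -(887 / 1000) := by rw [hf]; linarith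
  by_contra hcon
  rw [not_le] at hcon
  have : Nu * (-(434 / 1000)) < Nu * X := mul_lt_mul_of_pos_left hcon (by linarith)
  nlinarith

/-- **Opposite spokes point away from each other**: `⟨v_i, v_{i+3}⟩ ≤ −0.434`.
[cite: Theil2006, §4.2 Lemma 4.7 (preprint p. 20); our constant] -/
private theorem ip_add_three_le (H : IsHexagonalNbhd α y z p) (hα : 0 < α) (hα' : α ≤ 1 / 200)
    (i : Fin 6) : ip (y (p (i + 3)) - y z) (y (p i) - y z) ≤ -(434 / 1000) := by
  have htwo := ip_add_two_le H hα hα' (i + 1)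
  rw [f12] at htwo
  obtain ⟨u, hu⟩ : ∃ u : Plane, u = y (p (i + 1)) - y z := ⟨_, rfl⟩
  obtain ⟨m, hm⟩ : ∃ m : Plane, m = y (p (i + 2)) - y z := ⟨_, rfl⟩
  obtain ⟨a, ha⟩ : ∃ a : Plane, a = y (p (i + 3)) - y z := ⟨_, rfl⟩
  obtain ⟨w, hw⟩ : ∃ w : Plane, w = y (p i) - y z := ⟨_, rfl⟩
  have hP1 := ip_succ_bounds H hα hα' i
  have hP2 := ip_succ_bounds H hα hα' (i + 1)
  have hP3 := ip_succ_bounds H hα hα' (i + 2)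
  have hQ1 : 21 / 25 ≤ det₂ (y (p i) - y z) (y (p (i + 1)) - y z) := H.le_det₂ hα hα' i
  have hQ2 := H.le_det₂ hα hα' (i + 1)
  have hQ3 := H.le_det₂ hα hα' (i + 2)
  have hu1 := spoke_sq_bounds H hα hα' (i + 1)
  have hm1 := spoke_sq_bounds H hα hα' (i + 2)
  rw [f11] at hP2 hQ2
  rw [f21] at hP3 hQ3
  rw [← hu, ← hw] at hP1 hQ1
  rw [← hu, ← hm] at hP2 hQ2
  rw [← hm, ← ha] at hP3 hQ3
  rw [← hu] at hu1
  rw [← hm] at hm1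
  rw [← ha, ← hu] at htwo
  rw [← ha, ← hw]
  have hfd : ‖m‖ ^ 2 * det₂ u a = ip u m * det₂ m a + det₂ u m * ip a m := by
    have := frame_det m u a
    rw [det₂_swap m u, ip_comm' m a] at this
    linarith
  have hf : ‖u‖ ^ 2 * ip a w = ip a u * ip u w - det₂ u a * det₂ w u := by
    have := frame_ip u a w
    rw [det₂_swap u w] at this
    linarith
  rw [ip_comm' u m] at hfd
  exact three_core hu1.1 hu1.2 hm1.1 hm1.2 hP1.1 hP2.1 hP3.1 hQ1 hQ2 hQ3 htwo hfd hf

/-- **Non-adjacent spokes**: for `j ∉ {i − 1, i, i + 1}`, `⟨v_i, v_j⟩ ≤ −0.434`.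
[cite: Theil2006, §4.2 Lemma 4.7 (preprint p. 20); our constant] -/
private theorem ip_le_of_not_adj (H : IsHexagonalNbhd α y z p) (hα : 0 < α) (hα' : α ≤ 1 / 200)
    {i j : Fin 6} (h0 : j ≠ i) (h1 : j ≠ i + 1) (h5 : j ≠ i - 1) :
    ip (y (p j) - y z) (y (p i) - y z) ≤ -(434 / 1000) := by
  obtain ⟨k, rfl⟩ : ∃ k, j = i + k := ⟨j - i, (add_sub_cancel i j).symm⟩
  have hk : k = 2 ∨ k = 3 ∨ k = 4 := by
    rcases (by decide : ∀ k : Fin 6, k = 0 ∨ k = 1 ∨ k = 2 ∨ k = 3 ∨ k = 4 ∨ k = 5) k with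
      rfl | rfl | h | h | h | rfl
    · exact absurd (add_zero i) h0
    · exact absurd rfl h1
    · exact Or.inl h
    · exact Or.inr (Or.inl h)
    · exact Or.inr (Or.inr h)
    · exact absurd (f5 i) h5
  rcases hk with rfl | rfl | rfl
  · exact ip_add_two_le H hα hα' i
  · exact ip_add_three_le H hα hα' i
  · rw [ip_comm']
    have := ip_add_two_le H hα hα' (i + 4)
    rwa [f42] at this

/-- **The direction of an entry spoke.** If `p_i` is no farther from `t` than `y(z)` while
`p_{i−1}` is no closer, then `v_i = y(p_i) − y(z)` satisfies
`⟨v_i, t − y(z)⟩ > 0` and `det(v_i, t − y(z)) ≥ −0.33`.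
[cite: Theil2006, §4.2 Lemma 4.7 (preprint p. 20); our lemma] -/
private theorem entry_dir (H : IsHexagonalNbhd α y z p) (hα : 0 < α) (hα' : α ≤ 1 / 200)
    {t : Plane} {i : Fin 6}
    (hin : dist (y (p i)) t ≤ dist (y z) t) (hout : dist (y z) t ≤ dist (y (p (i - 1))) t) :
    0 < ip (y (p i) - y z) (t - y z) ∧ -(33 / 100) ≤ det₂ (y (p i) - y z) (t - y z) := by
  have hP := ip_succ_bounds H hα hα' (i - 1)
  have hQ := H.le_det₂ hα hα' (i - 1)
  have hv1 := spoke_sq_bounds H hα hα' i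
  have ha1 := spoke_sq_bounds H hα hα' (i - 1)
  rw [fin6_sub_one_add_one] at hP hQ
  obtain ⟨e, he⟩ : ∃ e : Plane, e = t - y z := ⟨_, rfl⟩
  obtain ⟨v, hv⟩ : ∃ v : Plane, v = y (p i) - y z := ⟨_, rfl⟩
  obtain ⟨a, ha⟩ : ∃ a : Plane, a = y (p (i - 1)) - y z := ⟨_, rfl⟩
  have hdz : dist (y z) t = ‖e‖ := by rw [he, dist_eq_norm, ← norm_neg, neg_sub]
  have hdi : dist (y (p i)) t = ‖v - e‖ := by
    rw [dist_eq_norm]; congr 1; rw [hv, he]; abel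
  have hda : dist (y (p (i - 1))) t = ‖a - e‖ := by
    rw [dist_eq_norm]; congr 1; rw [ha, he]; abel
  rw [hdz] at hin hout
  rw [hdi] at hin
  rw [hda] at hout
  rw [← hv, ← ha] at hP hQ
  rw [← hv] at hv1
  rw [← ha] at ha1
  rw [← hv, ← he]
  obtain ⟨hP, hP'⟩ := hP
  obtain ⟨hv1, hv1'⟩ := hv1
  obtain ⟨ha1, ha1'⟩ := ha1
  have e1 := norm_sub_sq_ip' v e
  have e2 := norm_sub_sq_ip' a e
  have hin2 : ‖v - e‖ ^ 2 ≤ ‖e‖ ^ 2 := pow_le_pow_left₀ (norm_nonneg _) hin 2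
  have hout2 : ‖e‖ ^ 2 ≤ ‖a - e‖ ^ 2 := pow_le_pow_left₀ (norm_nonneg _) hout 2
  have hipv : ‖v‖ ^ 2 ≤ 2 * ip v e := by linarith
  have hipa : 2 * ip a e ≤ ‖a‖ ^ 2 := by linarith
  refine ⟨by linarith, ?_⟩
  -- frame of `v`: ‖v‖² ⟨a, e⟩ = ⟨a, v⟩⟨v, e⟩ + det(v, a) det(v, e)
  have hf := frame_ip v a e
  have hPc : ip a v = ip v a := ip_comm' _ _
  have hQ' : det₂ v a = -det₂ a v := det₂_swap _ _
  have h1 : det₂ a v * det₂ v e = ip v a * ip v e - ‖v‖ ^ 2 * ip a e := by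
    rw [hQ', hPc] at hf; linarith
  -- ⟨v, a⟩⟨v, e⟩ ≥ 0.485 · 0.495 and ‖v‖²⟨a, e⟩ ≤ 1.0101 · 0.50505
  have hve : 495 / 1000 ≤ ip v e := by linarith
  have t1 : 485 / 1000 * (495 / 1000) ≤ ip v a * ip v e :=
    mul_le_mul hP hve (by norm_num) (by linarith)
  have hae : ip a e ≤ 50505 / 100000 := by linarith
  have t2 : ‖v‖ ^ 2 * ip a e ≤ 10101 / 10000 * (50505 / 100000) := by
    by_cases h0 : 0 ≤ ip a e
    · exact mul_le_mul hv1' hae h0 (by norm_num)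
    · rw [not_le] at h0
      have : ‖v‖ ^ 2 * ip a e ≤ 0 := mul_nonpos_of_nonneg_of_nonpos (sq_nonneg _) h0.le
      linarith
  have hkey : -(2702 / 10000) ≤ det₂ a v * det₂ v e := by rw [h1]; linarith
  by_contra hcon
  rw [not_le] at hcon
  have : det₂ a v * det₂ v e ≤ 21 / 25 * det₂ v e :=
    mul_le_mul_of_nonpos_right hQ (by linarith)
  linarith

/-- The real-arithmetic core of `entries_subsingleton`: two entry spokes cannot be
non-adjacent. [folklore] -/
private theorem entries_core {E X a b pv pw nv nw : ℝ} (hE : 99 / 100 ≤ E)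
    (hnv : nv ≤ 10101 / 10000) (hnw : nw ≤ 10101 / 10000) (hLv : pv ^ 2 + a ^ 2 = nv * E ^ 2)
    (hLw : pw ^ 2 + b ^ 2 = nw * E ^ 2) (hpv : 0 < pv) (hpw : 0 < pw) (ha : -(33 / 100) ≤ a)
    (hb : -(33 / 100) ≤ b) (hip : X ≤ -(434 / 1000)) (hf : E ^ 2 * X = pv * pw + b * a) :
    False := by
  have hE0 : 0 < E := by linarith
  -- |a|, |b| ≤ 1.006 E
  have ha' : a ≤ 1006 / 1000 * E := by
    by_contra h
    rw [not_le] at h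
    nlinarith [sq_nonneg pv]
  have hb' : b ≤ 1006 / 1000 * E := by
    by_contra h
    rw [not_le] at h
    nlinarith [sq_nonneg pw]
  -- b a ≥ −0.34 E
  have hprod : -(34 / 100) * E ≤ b * a := by
    by_cases hsa : 0 ≤ a
    · by_cases hsb : 0 ≤ b
      · nlinarith [mul_nonneg hsb hsa]
      · rw [not_le] at hsb
        have : -(33 / 100) * a ≤ b * a := mul_le_mul_of_nonneg_right hb hsa
        nlinarith
    · rw [not_le] at hsa
      by_cases hsb : 0 ≤ b
      · have : b * -(33 / 100) ≤ b * a := mul_le_mul_of_nonneg_left ha hsb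
        nlinarith
      · rw [not_le] at hsb
        nlinarith [mul_pos_of_neg_of_neg hsb hsa]
  have h1 : -(34 / 100) * E < E ^ 2 * X := by rw [hf]; nlinarith [mul_pos hpv hpw]
  have h2 : E ^ 2 * X ≤ E ^ 2 * (-(434 / 1000)) := mul_le_mul_of_nonneg_left hip (sq_nonneg _)
  nlinarith

/-- **At most one entry.** Let `z` have a hexagonal neighbourhood, `|y(z) − t| ≥ 0.99`, and let
`O` be a set of rim indices containing every rim particle strictly closer to `t` than `y(z)` and
only rim particles no farther than `y(z)`. Then walking around the rim one enters `O` at most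
once: if `i, j ∈ O` and `i − 1, j − 1 ∉ O` then `i = j`. (Entry spokes point into a fixed
half-plane region, non-adjacent spokes are `≥ 115°` apart.) [cite: Theil2006, §4.2 Lemma 4.7 and
proof of Proposition 4.8 (preprint pp. 20–21); our lemma] -/
theorem IsHexagonalNbhd.entries_subsingleton (H : IsHexagonalNbhd α y z p) (hα : 0 < α)
    (hα' : α ≤ 1 / 200) {t : Plane} (hd : 99 / 100 ≤ dist (y z) t) {O : Set (Fin 6)}
    (hin : ∀ i, dist (y (p i)) t < dist (y z) t → i ∈ O)
    (hout : ∀ i ∈ O, dist (y (p i)) t ≤ dist (y z) t) {i j : Fin 6} (hi : i ∈ O)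
    (hi' : i - 1 ∉ O) (hj : j ∈ O) (hj' : j - 1 ∉ O) : i = j := by
  by_contra hne
  have hout' : ∀ k, k ∉ O → dist (y z) t ≤ dist (y (p k)) t := fun k hk => by
    by_contra h; exact hk (hin k (lt_of_not_ge h))
  obtain ⟨hvi, hdi⟩ := entry_dir H hα hα' (hout i hi) (hout' _ hi')
  obtain ⟨hvj, hdj⟩ := entry_dir H hα hα' (hout j hj) (hout' _ hj')
  -- non-adjacent: `j ≠ i ± 1`
  have h1 : j ≠ i + 1 := by rintro rfl; exact hj' (by rwa [add_sub_cancel_right])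
  have h5 : j ≠ i - 1 := by rintro rfl; exact hi' hj
  have hip := ip_le_of_not_adj H hα hα' (fun h => hne h.symm) h1 h5
  -- frame of `e = t − y z`: ‖e‖² ⟨v_j, v_i⟩ = ⟨v_i, e⟩⟨v_j, e⟩ + det(v_j, e) det(v_i, e)
  have hv1 := spoke_sq_bounds H hα hα' i
  have hw1 := spoke_sq_bounds H hα hα' j
  obtain ⟨e, he⟩ : ∃ e : Plane, e = t - y z := ⟨_, rfl⟩
  obtain ⟨v, hv⟩ : ∃ v : Plane, v = y (p i) - y z := ⟨_, rfl⟩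
  obtain ⟨w, hw⟩ : ∃ w : Plane, w = y (p j) - y z := ⟨_, rfl⟩
  have hdz : dist (y z) t = ‖e‖ := by rw [he, dist_eq_norm, ← norm_neg, neg_sub]
  rw [hdz] at hd
  rw [← hv, ← he] at hvi hdi
  rw [← hw, ← he] at hvj hdj
  rw [← hv, ← hw] at hip
  rw [← hv] at hv1
  rw [← hw] at hw1
  obtain ⟨-, hv1'⟩ := hv1
  obtain ⟨-, hw1'⟩ := hw1
  have hf : ‖e‖ ^ 2 * ip w v = ip v e * ip w e + det₂ w e * det₂ v e := by
    have := frame_ip e w v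
    rw [det₂_swap e w, det₂_swap e v, neg_mul_neg, ip_comm' e v] at this
    linarith
  exact entries_core hd hv1' hw1' (ip_sq_add_det₂_sq' v e) (ip_sq_add_det₂_sq' w e) hvi hvj hdi
    hdj hip hf

/-- **The closer rim particles form an arc.** Under the hypotheses of `entries_subsingleton`
there is a base index `i₀` such that every other index of `O` has its predecessor in `O`.
[cite: Theil2006, §4.2 proof of Proposition 4.8 (preprint p. 21); our lemma] -/
theorem IsHexagonalNbhd.exists_arc_base (H : IsHexagonalNbhd α y z p) (hα : 0 < α)
    (hα' : α ≤ 1 / 200) {t : Plane} (hd : 99 / 100 ≤ dist (y z) t) {O : Set (Fin 6)}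
    (hin : ∀ i, dist (y (p i)) t < dist (y z) t → i ∈ O)
    (hout : ∀ i ∈ O, dist (y (p i)) t ≤ dist (y z) t) :
    ∃ i₀ : Fin 6, ∀ i ∈ O, i ≠ i₀ → i - 1 ∈ O := by
  by_cases h : ∃ i₀ ∈ O, i₀ - 1 ∉ O
  · obtain ⟨i₀, hi₀, hi₀'⟩ := h
    refine ⟨i₀, fun i hi hne => ?_⟩
    by_contra hi'
    exact hne (H.entries_subsingleton hα hα' hd hin hout hi hi' hi₀ hi₀')
  · push Not at h
    exact ⟨0, fun i hi _ => h i hi⟩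

end Wheel

/-! ### Consistency of charts and the extension step -/

section Charts

variable {X : Type*} {α : ℝ} {y : X → Plane}

/-- `R_{π/3}` is injective on labels. [folklore] -/
private theorem rot60_injective' : Function.Injective rot60 := by
  intro k k' h
  simp only [rot60, Prod.mk.injEq] at h
  obtain ⟨h1, h2⟩ := h
  ext <;> omega

/-- **Two discrete imbeddings which agree on an `𝒮`-bond agree on every `𝒮`-triangle through
it** (each maps the triangle to a unit lattice triangle with the orientation dictated by (20)).
The two imbeddings may live on different patches containing the triangle.
[cite: Theil2006, §2.3 Definition 2.4 (20), Remark 2.5; §4.2 Lemma 4.7 (uniqueness) (preprint pp. 7, 20); our lemma] -/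
theorem IsDiscreteImbeddingOn.eq_of_triangle {ω₁ ω₂ : Set X} {φ ψ : X → ℤ × ℤ}
    (hφ : IsDiscreteImbeddingOn α y ω₁ φ) (hψ : IsDiscreteImbeddingOn α y ω₂ ψ) (hα : 0 < α)
    (hα' : α ≤ 1 / 200) {a b c : X} (ha₁ : a ∈ ω₁) (hb₁ : b ∈ ω₁) (hc₁ : c ∈ ω₁) (ha₂ : a ∈ ω₂)
    (hb₂ : b ∈ ω₂) (hc₂ : c ∈ ω₂) (hab : IsShortRange α y a b) (hac : IsShortRange α y a c)
    (hbc : IsShortRange α y b c) (h_a : φ a = ψ a) (h_b : φ b = ψ b) : φ c = ψ c := by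
  have hα1 : α < 1 := by linarith
  have hsq := sq_le_det₂_sq_of_isShortRange hα hα' hab hac hbc
  have hne : det₂ (y b - y a) (y c - y a) ≠ 0 := fun h => by rw [h] at hsq; norm_num at hsq
  rcases lt_or_gt_of_ne hne with hneg | hpos
  · have hpos' : 0 < det₂ (y c - y a) (y b - y a) := by rw [det₂_swap]; linarith
    have e1 := hφ.sub_eq_rot60_of_det_pos hα1 ha₁ hc₁ hb₁ hac hab hbc.symm hpos'
    have e2 := hψ.sub_eq_rot60_of_det_pos hα1 ha₂ hc₂ hb₂ hac hab hbc.symm hpos'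
    rw [h_a, h_b, e2] at e1
    have := rot60_injective' e1
    rw [← h_a] at this
    exact (sub_left_injective this).symm
  · have e1 := hφ.sub_eq_rot60_of_det_pos hα1 ha₁ hb₁ hc₁ hab hac hbc hpos
    have e2 := hψ.sub_eq_rot60_of_det_pos hα1 ha₂ hb₂ hc₂ hab hac hbc hpos
    rw [h_a, h_b, ← e2] at e1
    exact sub_left_injective e1

/-- A map that agrees with a discrete imbedding on the patch is a discrete imbedding of the patch.
[cite: Theil2006, §2.3 Definition 2.4 (preprint p. 7)] -/
theorem IsDiscreteImbeddingOn.congr {ω : Set X} {φ ψ : X → ℤ × ℤ}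
    (hφ : IsDiscreteImbeddingOn α y ω φ) (h : ∀ x ∈ ω, ψ x = φ x) :
    IsDiscreteImbeddingOn α y ω ψ := by
  refine ⟨fun x hx x' hx' hs => ?_, fun x₁ h₁ x₂ h₂ x₃ h₃ s₁₂ s₁₃ s₂₃ => ?_,
    fun x hx x' hx' he => ?_⟩
  · rw [h x hx, h x' hx']; exact hφ.continuousOn hx hx' hs
  · rw [h x₁ h₁, h x₂ h₂, h x₃ h₃]; exact hφ.orientationOn h₁ h₂ h₃ s₁₂ s₁₃ s₂₃
  · rw [h x hx, h x' hx'] at he; exact hφ.injOn hx hx' he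

/-- A hexagonal neighbourhood can be listed from any of its rim particles. [cite: Theil2006, §4.2 Lemma 4.7 (preprint p. 20)] -/
theorem IsHexagonalNbhd.shift {x : X} {p : Fin 6 → X} (H : IsHexagonalNbhd α y x p) (k : Fin 6) :
    IsHexagonalNbhd α y x (fun i => p (k + i)) where
  injective i j h := by simpa using H.injective h
  isShortRange_centre i := H.isShortRange_centre (k + i)
  mem_range_of_isShortRange := by
    intro b hb
    obtain ⟨i, rfl⟩ := H.mem_range_of_isShortRange hb
    exact ⟨i - k, by simp⟩
  isShortRange_succ i := by
    have := H.isShortRange_succ (k + i); rwa [add_assoc] at this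
  not_isShortRange_add_two i := by
    have := H.not_isShortRange_add_two (k + i); rwa [add_assoc] at this
  not_isShortRange_add_three i := by
    have := H.not_isShortRange_add_three (k + i); rwa [add_assoc] at this
  det_pos i := by
    have := H.det_pos (k + i); rwa [add_assoc] at this

/-- **Local charts agreeing with a label map.** Every particle of `D` has a discrete imbedding of
its neighbourhood `𝒩(q)` that agrees with `Φ` at the points of `𝒩(q)` lying in `D`.
[cite: Theil2006, §4.2 proof of Proposition 4.8 (64) (preprint p. 21); our bookkeeping] -/
def AgreesLocally (α : ℝ) (y : X → Plane) (D : Set X) (Φ : X → ℤ × ℤ) : Prop :=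
  ∀ q ∈ D, ∃ φ : X → ℤ × ℤ, IsDiscreteImbeddingOn α y (nbhdSet α y q) φ ∧
    ∀ b ∈ nbhdSet α y q, b ∈ D → φ b = Φ b

/-- If the indices of `O ⊆ Fin 6` other than `i₀` all have their predecessor in `O` and `O` is
nonempty, then some BASE index of `O` has this property. [folklore] -/
private theorem exists_base_mem {O : Set (Fin 6)} {i₀ : Fin 6}
    (harc : ∀ i ∈ O, i ≠ i₀ → i - 1 ∈ O) (hne : O.Nonempty) :
    ∃ j₀ ∈ O, ∀ i ∈ O, i ≠ j₀ → i - 1 ∈ O := by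
  by_cases h0 : i₀ ∈ O
  · exact ⟨i₀, h0, harc⟩
  · obtain ⟨j, hj⟩ := hne
    have h1 : ∀ i ∈ O, i - 1 ∈ O := fun i hi => harc i hi fun h => h0 (h ▸ hi)
    have h2 := h1 _ (h1 j hj)
    have h3 := h1 _ h2
    have h4 := h1 _ h3
    have h5 := h1 _ h4
    have hall : ∀ d : Fin 6, j - d ∈ O := by
      intro d
      rcases (by decide : ∀ d : Fin 6, d = 0 ∨ d = 1 ∨ d = 2 ∨ d = 3 ∨ d = 4 ∨ d = 5) d with
        rfl | rfl | rfl | rfl | rfl | rfl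
      · simpa using hj
      · exact h1 j hj
      · rwa [sub_sub] at h2
      · rwa [sub_sub, sub_sub] at h3
      · rwa [sub_sub, sub_sub, sub_sub] at h4
      · rwa [sub_sub, sub_sub, sub_sub, sub_sub] at h5
    exfalso
    apply h0
    have := hall (j - i₀)
    rwa [sub_sub_cancel] at this

/-- Arc induction on `Fin 6`: a property that holds at the base `i₀ ∈ O` and passes from `i − 1`
to `i` inside `O` holds on all of `O`, when every index of `O` other than `i₀` has its
predecessor in `O`. [folklore] -/
private theorem arc_induction {O : Set (Fin 6)} {i₀ : Fin 6} (hi₀ : i₀ ∈ O)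
    (harc : ∀ i ∈ O, i ≠ i₀ → i - 1 ∈ O) {P : Fin 6 → Prop} (h0 : P i₀)
    (hstep : ∀ i ∈ O, i - 1 ∈ O → P (i - 1) → P i) : ∀ i ∈ O, P i := by
  suffices h : ∀ (k : ℕ) (i : Fin 6), i ∈ O → (i - i₀).val = k → P i from
    fun i hi => h _ i hi rfl
  intro k
  induction k with
  | zero =>
    intro i _ hk
    have : i - i₀ = 0 := Fin.ext hk
    rw [sub_eq_zero] at this
    rw [this]; exact h0
  | succ k ih =>
    intro i hi hk
    have hne : i ≠ i₀ := by
      rintro rfl; simp at hk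
    have hpred := harc i hi hne
    refine hstep i hi hpred (ih (i - 1) hpred ?_)
    have hne0 : i - i₀ ≠ 0 := fun h => by rw [h] at hk; simp at hk
    have e : i - 1 - i₀ = (i - i₀) - 1 := by abel
    rw [e, Fin.coe_sub_one, if_neg hne0, hk]
    rfl

/-- **The extension step.** Let `z ∉ D` have a hexagonal neighbourhood `p`, let `Φ` carry local
charts on `D` (`AgreesLocally`), and suppose the rim particles of `z` lying in `D` form an arc
(every one except a base has its rim predecessor in `D`). Then `Φ` can be modified at `z` so as
to carry local charts on `D ∪ {z}`: the new label is read off the chart of the base particle, and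
consecutive charts along the arc agree at `z` (`IsDiscreteImbeddingOn.eq_of_triangle`).
[cite: Theil2006, §4.2 proof of Proposition 4.8 (64) with Lemma 4.7 (preprint pp. 20–21); our combinatorial form] -/
theorem extend_charts (hα : 0 < α) (hα' : α ≤ 1 / 200) {z : X} {p : Fin 6 → X}
    (H : IsHexagonalNbhd α y z p) {D : Set X} (hzD : z ∉ D) {Φ : X → ℤ × ℤ}
    (hD : AgreesLocally α y D Φ) (harc : ∃ i₀, ∀ i, p i ∈ D → i ≠ i₀ → p (i - 1) ∈ D) :
    ∃ Φ' : X → ℤ × ℤ, (∀ b ∈ D, Φ' b = Φ b) ∧ AgreesLocally α y (insert z D) Φ' := by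
  classical
  have hα1 : α < 1 := by linarith
  have hzz : z ∈ nbhdSet α y z := mem_nbhdSet_self z
  have hpz : ∀ i, p i ∈ nbhdSet α y z := fun i => (H.isShortRange_centre i).mem_nbhdSet
  -- a rim particle of `z` in `D` is some `p i`
  have hrim : ∀ b ∈ nbhdSet α y z, b ∈ D → ∃ i, b = p i := by
    intro b hb hbD
    rw [mem_nbhdSet_iff] at hb
    rcases hb with rfl | hb
    · exact absurd hbD hzD
    · obtain ⟨i, rfl⟩ := H.mem_range_of_isShortRange hb
      exact ⟨i, rfl⟩
  by_cases hO : ∃ i, p i ∈ D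
  swap
  · -- no labelled neighbour: keep `Φ`, chart `z` freely
    push Not at hO
    refine ⟨Φ, fun _ _ => rfl, ?_⟩
    intro q hq
    rcases hq with rfl | hq
    · have h10 : ((Φ q + (1, 0)) - Φ q) ∈ unitShell := by rw [add_sub_cancel_left]; decide
      obtain ⟨φ, hφ, hφz, -, -⟩ := H.exists_discreteImbedding hα1 h10
      refine ⟨φ, hφ, fun b hb hbD => ?_⟩
      rcases hbD with rfl | hbD
      · exact hφz
      · obtain ⟨i, rfl⟩ := hrim b hb hbD
        exact absurd hbD (hO i)
    · obtain ⟨φ, hφ, hφD⟩ := hD q hq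
      refine ⟨φ, hφ, fun b hb hbD => ?_⟩
      rcases hbD with rfl | hbD
      · -- `z ∈ 𝒩(q)` would make `q` a labelled rim particle of `z`
        rw [mem_nbhdSet_iff] at hb
        rcases hb with rfl | hb
        · exact absurd hq hzD
        · obtain ⟨i, rfl⟩ := H.mem_range_of_isShortRange hb.symm
          exact absurd hq (hO i)
      · exact hφD b hb hbD
  -- the arc of labelled rim particles and its base
  set O : Set (Fin 6) := {i | p i ∈ D} with hO_def
  obtain ⟨i₁, hi₁⟩ := harc
  obtain ⟨i₀, hi₀, hbase⟩ := exists_base_mem (O := O) (i₀ := i₁)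
    (fun i hi hne => hi₁ i hi hne) (let ⟨i, hi⟩ := hO; ⟨i, hi⟩)
  have hw : p i₀ ∈ D := hi₀
  obtain ⟨φw, hφw, hφwD⟩ := hD (p i₀) hw
  -- the new label of `z`
  set L := φw z with hL
  have hzw : z ∈ nbhdSet α y (p i₀) := (H.isShortRange_centre i₀).symm.mem_nbhdSet
  -- (A) every labelled rim particle has a chart agreeing with `Φ` on `D` and taking `z` to `L`
  have hA : ∀ i ∈ O, ∃ χ : X → ℤ × ℤ, IsDiscreteImbeddingOn α y (nbhdSet α y (p i)) χ ∧
      (∀ b ∈ nbhdSet α y (p i), b ∈ D → χ b = Φ b) ∧ χ z = L := by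
    refine arc_induction hi₀ hbase ⟨φw, hφw, hφwD, rfl⟩ ?_
    intro i hi hpred ⟨χ', hχ', hχ'D, hχ'z⟩
    obtain ⟨φi, hφi, hφiD⟩ := hD (p i) hi
    refine ⟨φi, hφi, hφiD, ?_⟩
    -- the triangle `p (i-1), p i, z`
    have hsucc : IsShortRange α y (p (i - 1)) (p i) := by
      have := H.isShortRange_succ (i - 1); rwa [fin6_sub_one_add_one] at this
    have e := IsDiscreteImbeddingOn.eq_of_triangle hχ' hφi hα hα' (mem_nbhdSet_self _)
      hsucc.mem_nbhdSet (H.isShortRange_centre (i - 1)).symm.mem_nbhdSet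
      hsucc.symm.mem_nbhdSet (mem_nbhdSet_self _) (H.isShortRange_centre i).symm.mem_nbhdSet
      hsucc (H.isShortRange_centre (i - 1)).symm (H.isShortRange_centre i).symm
      (by rw [hχ'D _ (mem_nbhdSet_self _) hpred, hφiD _ hsucc.symm.mem_nbhdSet hpred])
      (by rw [hχ'D _ hsucc.mem_nbhdSet hi, hφiD _ (mem_nbhdSet_self _) hi])
    rw [← e, hχ'z]
  -- (B) the chart of `z`: value `L` at `z`, `Φ (p i₀)` at the base
  have hunit : Φ (p i₀) - L ∈ unitShell := by
    rw [← hφwD _ (mem_nbhdSet_self _) hw, hL]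
    exact hφw.sub_mem_unitShell hα1 hzw (mem_nbhdSet_self _) (H.isShortRange_centre i₀)
  obtain ⟨φz, hφz, hφzz, hφz0, -⟩ := (H.shift i₀).exists_discreteImbedding hα1 hunit
  simp only [add_zero] at hφz0
  have hB : ∀ i ∈ O, φz (p i) = Φ (p i) := by
    refine arc_induction hi₀ hbase hφz0 ?_
    intro i hi hpred hP
    obtain ⟨χ', hχ', hχ'D, hχ'z⟩ := hA (i - 1) hpred
    have hsucc : IsShortRange α y (p (i - 1)) (p i) := by
      have := H.isShortRange_succ (i - 1); rwa [fin6_sub_one_add_one] at this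
    -- the triangle `z, p (i-1), p i`
    have e := IsDiscreteImbeddingOn.eq_of_triangle hφz hχ' hα hα' hzz (hpz (i - 1)) (hpz i)
      (H.isShortRange_centre (i - 1)).symm.mem_nbhdSet (mem_nbhdSet_self _) hsucc.mem_nbhdSet
      (H.isShortRange_centre (i - 1)) (H.isShortRange_centre i) hsucc
      (by rw [hφzz, hχ'z]) (by rw [hP, hχ'D _ (mem_nbhdSet_self _) hpred])
    rw [e, hχ'D _ hsucc.mem_nbhdSet hi]
  -- assemble
  refine ⟨Function.update Φ z L, fun b hb => Function.update_of_ne (ne_of_mem_of_not_mem hb hzD) _ _,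
    ?_⟩
  intro q hq
  rcases hq with rfl | hq
  · refine ⟨φz, hφz, fun b hb hbD => ?_⟩
    rcases hbD with rfl | hbD
    · rw [Function.update_self]; exact hφzz
    · obtain ⟨i, rfl⟩ := hrim b hb hbD
      rw [Function.update_of_ne (ne_of_mem_of_not_mem hbD hzD)]
      exact hB i hbD
  · by_cases hqz : IsShortRange α y q z
    · obtain ⟨i, rfl⟩ := H.mem_range_of_isShortRange hqz.symm
      obtain ⟨χ, hχ, hχD, hχz⟩ := hA i hq
      refine ⟨χ, hχ, fun b hb hbD => ?_⟩
      rcases hbD with rfl | hbD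
      · rw [Function.update_self]; exact hχz
      · rw [Function.update_of_ne (ne_of_mem_of_not_mem hbD hzD)]; exact hχD b hb hbD
    · obtain ⟨φ, hφ, hφD⟩ := hD q hq
      refine ⟨φ, hφ, fun b hb hbD => ?_⟩
      rcases hbD with rfl | hbD
      · rw [mem_nbhdSet_iff] at hb
        rcases hb with rfl | hb
        · exact absurd hq hzD
        · exact absurd hb hqz
      · rw [Function.update_of_ne (ne_of_mem_of_not_mem hbD hzD)]; exact hφD b hb hbD

end Charts

/-! ### The induction over the disc -/

section Disc

variable {X : Type*} [Finite X] {α : ℝ} {y : X → Plane}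

/-- **The label map of a defect-free disc.** Let `y` satisfy (13) with `0 < α ≤ 1/200` and let
no particle within `ρ₀ + 1 + α` of `y(x_c)` be a defect. Then there is `Φ : X → ℤ²` carrying local
charts on the disc `{b : |y(b) − y(x_c)| < ρ₀}`: every particle `q` of the disc has a discrete
imbedding of `𝒩(q)` agreeing with `Φ` at the points of `𝒩(q)` in the disc. (Induction on the
particles of the disc in the order of their distance to `y(x_c)`; the step is `extend_charts`,
its arc hypothesis is `IsHexagonalNbhd.exists_arc_base`.) [cite: Theil2006, §4.2 proof of
Proposition 4.8, (64) with Lemma 4.6 and Lemma 4.7 (preprint pp. 20–21); our combinatorial form] -/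
theorem exists_agreesLocally (hα : 0 < α) (hα' : α ≤ 1 / 200)
    (hsep : ∀ x x' : X, x ≠ x' → 1 - α < dist (y x) (y x')) (x_c : X) {ρ₀ : ℝ}
    (hdef : ∀ b, dist (y b) (y x_c) < ρ₀ + 1 + α → b ∉ defectSet α y) :
    ∃ Φ : X → ℤ × ℤ, AgreesLocally α y {b | dist (y b) (y x_c) < ρ₀} Φ := by
  classical
  haveI := Fintype.ofFinite X
  have hα1 : α < 1 := by linarith
  -- induction on downward closed finite parts of the disc
  suffices h : ∀ (n : ℕ) (D : Finset X), D.card = n → (∀ b ∈ D, dist (y b) (y x_c) < ρ₀) →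
      (∀ b ∈ D, ∀ b', dist (y b') (y x_c) < dist (y b) (y x_c) → b' ∈ D) →
      ∃ Φ : X → ℤ × ℤ, AgreesLocally α y ↑D Φ by
    set B : Finset X := Finset.univ.filter fun b => dist (y b) (y x_c) < ρ₀ with hB
    obtain ⟨Φ, hΦ⟩ := h B.card B rfl (fun b hb => (Finset.mem_filter.1 hb).2)
      (fun b hb b' hb' => Finset.mem_filter.2 ⟨Finset.mem_univ _,
        hb'.trans (Finset.mem_filter.1 hb).2⟩)
    refine ⟨Φ, ?_⟩
    have e : (↑B : Set X) = {b | dist (y b) (y x_c) < ρ₀} := by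
      ext b; simp [hB]
    rwa [e] at hΦ
  intro n
  induction n with
  | zero =>
    intro D hD _ _
    rw [Finset.card_eq_zero] at hD
    subst hD
    exact ⟨fun _ => 0, fun q hq => absurd hq (by simp)⟩
  | succ n ih =>
    intro D hcard hdisc hdown
    have hne : D.Nonempty := by
      rw [← Finset.card_pos, hcard]; exact Nat.succ_pos n
    obtain ⟨z, hzD, hzmax⟩ := Finset.exists_max_image D (fun b => dist (y b) (y x_c)) hne
    set D' := D.erase z with hD'
    have hcard' : D'.card = n := by rw [hD', Finset.card_erase_of_mem hzD, hcard, Nat.add_sub_cancel]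
    have hdisc' : ∀ b ∈ D', dist (y b) (y x_c) < ρ₀ := fun b hb =>
      hdisc b (Finset.mem_of_mem_erase hb)
    have hdown' : ∀ b ∈ D', ∀ b', dist (y b') (y x_c) < dist (y b) (y x_c) → b' ∈ D' := by
      intro b hb b' hb'
      have hb'D := hdown b (Finset.mem_of_mem_erase hb) b' hb'
      refine Finset.mem_erase.2 ⟨?_, hb'D⟩
      rintro rfl
      exact absurd (hzmax b (Finset.mem_of_mem_erase hb)) (not_le.2 hb')
    obtain ⟨Φ, hΦ⟩ := ih D' hcard' hdisc' hdown'
    -- the wheel of `z`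
    have hzρ := hdisc z hzD
    have hz : z ∉ defectSet α y := hdef z (by linarith)
    have hN : ∀ ⦃b⦄, IsShortRange α y z b → b ∉ defectSet α y := by
      intro b hb
      refine hdef b ?_
      calc dist (y b) (y x_c) ≤ dist (y b) (y z) + dist (y z) (y x_c) := dist_triangle _ _ _
        _ < (1 + α) + ρ₀ := by
            have := hb.dist_le; rw [dist_comm] at this; linarith
        _ = ρ₀ + 1 + α := by ring
    obtain ⟨a, ha⟩ : {x' | IsShortRange α y z x'}.Nonempty :=
      Set.nonempty_of_ncard_ne_zero (by rw [ncard_neighbours_eq_six hα1 hz]; norm_num)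
    obtain ⟨p, -, H⟩ := exists_isHexagonalNbhd hα hα' hsep hz hN ha
    have hzD' : z ∉ (↑D' : Set X) := fun h => by simp [hD'] at h
    -- the labelled rim particles form an arc
    have harc : ∃ i₀, ∀ i, p i ∈ (↑D' : Set X) → i ≠ i₀ → p (i - 1) ∈ (↑D' : Set X) := by
      by_cases hO : ∃ i, p i ∈ D'
      swap
      · push Not at hO
        exact ⟨0, fun i hi _ => absurd (Finset.mem_coe.1 hi) (hO i)⟩
      obtain ⟨j, hj⟩ := hO
      -- `z ≠ x_c`, so `|y z − y x_c| > 1 − α ≥ 0.99`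
      have hd : 99 / 100 ≤ dist (y z) (y x_c) := by
        have hjD := Finset.mem_of_mem_erase hj
        have hjz : p j ≠ z := (H.centre_ne hα1 j).symm
        by_cases hzc : z = x_c
        · exfalso
          have h1 := hzmax (p j) hjD
          rw [hzc, dist_self] at h1
          have h2 : p j ≠ x_c := fun h => hjz (h.trans hzc.symm)
          have := hsep (p j) x_c h2
          linarith
        · have := hsep z x_c hzc; linarith
      have hin : ∀ i, dist (y (p i)) (y x_c) < dist (y z) (y x_c) →
          i ∈ {i | p i ∈ (↑D' : Set X)} := by
        intro i hi
        show p i ∈ (↑D' : Set X)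
        rw [Finset.mem_coe, hD', Finset.mem_erase]
        exact ⟨(H.centre_ne hα1 i).symm, hdown z hzD (p i) hi⟩
      obtain ⟨i₀, hi₀⟩ := H.exists_arc_base hα hα' hd hin
        (fun i hi => hzmax (p i) (Finset.mem_of_mem_erase (Finset.mem_coe.1 hi)))
      exact ⟨i₀, fun i hi hne => hi₀ i hi hne⟩
    obtain ⟨Φ', -, hΦ'⟩ := extend_charts hα hα' H hzD' hΦ harc
    refine ⟨Φ', ?_⟩
    have e : insert z (↑D' : Set X) = ↑D := by
      rw [hD', Finset.coe_erase, Set.insert_sdiff_singleton,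
        Set.insert_eq_of_mem (Finset.mem_coe.2 hzD)]
    rwa [e] at hΦ'

/-- **Every particle of the shrunken disc is charted.** Under the hypotheses of
`exists_agreesLocally`, the label map `Φ` restricts to a discrete imbedding of `𝒩(q)` for every
`q` with `|y(q) − y(x_c)| < ρ₀ − 1 − α`, and `q` has a hexagonal neighbourhood.
[cite: Theil2006, §4.2 proof of Proposition 4.8 with Lemma 4.7 (preprint pp. 20–21); our combinatorial form] -/
theorem exists_charted (hα : 0 < α) (hα' : α ≤ 1 / 200)
    (hsep : ∀ x x' : X, x ≠ x' → 1 - α < dist (y x) (y x')) (x_c : X) {ρ₀ : ℝ}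
    (hdef : ∀ b, dist (y b) (y x_c) < ρ₀ + 1 + α → b ∉ defectSet α y) :
    ∃ Φ : X → ℤ × ℤ, ∀ q, dist (y q) (y x_c) < ρ₀ - 1 - α →
      (∃ p : Fin 6 → X, IsHexagonalNbhd α y q p) ∧ IsDiscreteImbeddingOn α y (nbhdSet α y q) Φ := by
  have hα1 : α < 1 := by linarith
  obtain ⟨Φ, hΦ⟩ := exists_agreesLocally hα hα' hsep x_c hdef
  refine ⟨Φ, fun q hq => ?_⟩
  have hqN : ∀ b ∈ nbhdSet α y q, dist (y b) (y x_c) < ρ₀ := by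
    intro b hb
    rw [mem_nbhdSet_iff] at hb
    rcases hb with rfl | hb
    · linarith
    · calc dist (y b) (y x_c) ≤ dist (y b) (y q) + dist (y q) (y x_c) := dist_triangle _ _ _
        _ < (1 + α) + (ρ₀ - 1 - α) := by
            have := hb.dist_le; rw [dist_comm] at this; linarith
        _ = ρ₀ := by ring
  have hz : q ∉ defectSet α y := hdef q (by linarith)
  have hN : ∀ ⦃b⦄, IsShortRange α y q b → b ∉ defectSet α y := fun b hb =>
    hdef b (by have := hqN b hb.mem_nbhdSet; linarith)
  obtain ⟨a, ha⟩ : {x' | IsShortRange α y q x'}.Nonempty :=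
    Set.nonempty_of_ncard_ne_zero (by rw [ncard_neighbours_eq_six hα1 hz]; norm_num)
  obtain ⟨p, -, H⟩ := exists_isHexagonalNbhd hα hα' hsep hz hN ha
  obtain ⟨φ, hφ, hφΦ⟩ := hΦ q (by show dist (y q) (y x_c) < ρ₀; linarith)
  exact ⟨⟨p, H⟩, hφ.congr fun b hb => (hφΦ b hb (hqN b hb)).symm⟩

end Disc

end Theil2006

end Literature.MathematicalPhysics.StatisticalMechanics
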